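import Mathlib
import Literature.Computability.AlgebraicComplexity.BCGPUInfiniteGroups
import Summits.MatrixMultiplication.MatrixMultiplication.Theorems.SoloInformedSeparationCriterion
import Summits.MatrixMultiplication.MatrixMultiplication.Theorems.SoloInformedTwistRank

/-!
# Fixed degeneracy loci host boundedly many `Y`: the invariant-space form

Setting of Blasiak–Cohn–Grochow–Pratt–Umans (arXiv:2410.14905, Def. 2.1 / Thm. 2.2 / Cor. 2.8): TPP
designs `X, Y, Z` in a group `G` with separating functions in a finite-dimensional `V`; for the
Lie-group door `V = V_s = ` polynomials of degree `≤ s` on `GL_n(ℂ)`, and every `V_t` is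
invariant under left and right translations.

**New here (soloist).**
* `card_le_finrank_of_twists_in_locus`: if `U` is a finite-dimensional space of functions
  invariant under RIGHT translations, `Φ ∈ U`, `Φ(1) ≠ 0`, and every twist `y⁻¹y'` (`y ≠ y'` in
  `Y`) lies in `{Φ = 0}`, then `|Y| ≤ dim U`.  (Right-invariance makes the kernel
  `(y,y') ↦ Φ(y⁻¹y') = (R_{y'}Φ)(y⁻¹)` of rank `≤ dim U`; then the twist-rank lemma of
  `SoloInformedTwistRank`.)  For `U = V_t` on `GL_n`: twists inside a degree-`t` hypersurface
  not through `1` force `|Y| ≤ C(t+n², n²)` — independently of the degree `s` of the design.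
* `volume_le_of_twists_in_locus`: hence such a design has `|X||Y||Z| ≤ dim U · dim V`.
* `glN_card_le_of_affine_twists`: the case `U = V_1` on `GL_n(ℂ)` made explicit — twists in an
  affine hyperplane `{c + Σ L_{ij} w_{ij} = 0}` with `c + tr L ≠ 0` force `|Y| ≤ n² + 1`.
* `volume_le_of_cellFunction_mem`: a *cell-function design* (sibling file
  `SoloInformedSeparationCriterion`: `φ` vanishes at all twisted points and at no point of
  `Q = XZ⁻¹`) whose cell function lies in a BI-invariant `U` has `|Y| ≤ dim U` and
  `|X||Y||Z| ≤ dim U · dim V` (take `Φ = φ(x₀ · z₀⁻¹)`).  Reading for the `GL_n` door: a cell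
  function of degree `t` bounded independently of `s` caps the volume at `C(t+n²,n²) · dim V_s`
  — exponent `θ = 1`; super-density needs the degeneracy locus of the twists to have degree
  growing with `s` (cf. the flip design, `φ = g₁₁ ∈ V_1`, where the sharp count is `|Y| ≤ 2`).

References: [BlasiakCohnGrochowPrattUmans2024] arXiv:2410.14905, Def. 2.1, Thm. 2.2, Rem. 2.3,
Cor. 2.8, §4.
-/

noncomputable section

open scoped BigOperators
open Module

namespace Summit.MatrixMultiplication.MatrixMultiplication.Theorems

open Literature.Computability.AlgebraicComplexity

variable {G : Type*} [Group G]

/-- **Twists in a fixed locus `{Φ = 0}`, `Φ` in a right-invariant space `U`, force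
`|Y| ≤ dim U`.** [new] -/
theorem card_le_finrank_of_twists_in_locus (U : Submodule ℂ (G → ℂ)) [FiniteDimensional ℂ U]
    (hU : ∀ φ ∈ U, ∀ g : G, (fun h => φ (h * g)) ∈ U)
    (Φ : G → ℂ) (hΦ : Φ ∈ U) (h1 : Φ 1 ≠ 0) (Y : Finset G)
    (hY : ∀ y ∈ Y, ∀ y' ∈ Y, y ≠ y' → Φ (y⁻¹ * y') = 0) :
    Y.card ≤ finrank ℂ U := by
  classical
  let b := Module.finBasis ℂ U
  -- right translates of `Φ`, as elements of `U`
  let R : G → U := fun g => ⟨fun h => Φ (h * g), hU Φ hΦ g⟩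
  refine card_le_of_twist_rank Y Φ
    (fun k y => ((b k : U) : G → ℂ) y⁻¹) (fun k y' => b.repr (R y') k) ?_ h1 hY
  intro y _ y' _
  have hsum := congrArg (fun v : U => (v : G → ℂ) y⁻¹) (b.sum_repr (R y'))
  simp only [Submodule.coe_sum, Submodule.coe_smul, Finset.sum_apply, Pi.smul_apply,
    smul_eq_mul] at hsum
  calc Φ (y⁻¹ * y') = ((R y' : U) : G → ℂ) y⁻¹ := rfl
    _ = ∑ i, b.repr (R y') i * ((b i : U) : G → ℂ) y⁻¹ := hsum.symm
    _ = ∑ k, ((b k : U) : G → ℂ) y⁻¹ * b.repr (R y') k :=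
        Finset.sum_congr rfl fun _ _ => mul_comm _ _

/-- **Volume bound for designs with twists in a fixed locus.** TPP design (embedding form) with
a separating family in `V`, all twists in `{Φ = 0}` with `Φ ∈ U` right-invariant and `Φ(1) ≠ 0`:
`|X| · |Y| · |Z| ≤ dim U · dim V`. [new; cf. BlasiakCohnGrochowPrattUmans2024, Thm. 2.2] -/
theorem volume_le_of_twists_in_locus (U V : Submodule ℂ (G → ℂ)) [FiniteDimensional ℂ U]
    [FiniteDimensional ℂ V]
    (hU : ∀ φ ∈ U, ∀ g : G, (fun h => φ (h * g)) ∈ U)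
    (Φ : G → ℂ) (hΦ : Φ ∈ U) (h1 : Φ 1 ≠ 0)
    {X Y Z : Finset G}
    (hTPP : ∀ x ∈ X, ∀ x' ∈ X, ∀ y ∈ Y, ∀ y' ∈ Y, ∀ z ∈ Z, ∀ z' ∈ Z,
      x * y⁻¹ * y' * z⁻¹ = x' * z'⁻¹ → x = x' ∧ y = y' ∧ z = z')
    (f : G → G → (G → ℂ)) (hf : IsSeparatingFamily X Y Z f)
    (hfV : ∀ x ∈ X, ∀ z ∈ Z, f x z ∈ V)
    (htw : ∀ y ∈ Y, ∀ y' ∈ Y, y ≠ y' → Φ (y⁻¹ * y') = 0) :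
    X.card * Y.card * Z.card ≤ finrank ℂ U * finrank ℂ V := by
  rcases Y.eq_empty_or_nonempty with hY | hY
  · simp [hY]
  have hXZ : X.card * Z.card ≤ finrank ℂ V :=
    card_mul_le_finrank_of_separating V hY hTPP f hf hfV
  have hYU : Y.card ≤ finrank ℂ U := card_le_finrank_of_twists_in_locus U hU Φ hΦ h1 Y htw
  calc X.card * Y.card * Z.card = Y.card * (X.card * Z.card) := by ring
    _ ≤ finrank ℂ U * finrank ℂ V := Nat.mul_le_mul hYU hXZ

/-- **Cell-function designs with a cell function of bounded complexity are flat.** If `φ` lies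
in a BI-invariant finite-dimensional `U`, vanishes at every twisted point `x y⁻¹ y' z⁻¹`
(`y ≠ y'`) and at no point `x z⁻¹` (`X, Z ≠ ∅`), then `|Y| ≤ dim U` (with `Φ = φ(x₀ · z₀⁻¹) ∈ U`) and every
separating family in `V` gives `|X||Y||Z| ≤ dim U · dim V`. For `GL_n`, `U = V_t`:
`|Y| ≤ C(t+n²,n²)` whatever the degree `s` of the separators. [new] -/
theorem volume_le_of_cellFunction_mem (U V : Submodule ℂ (G → ℂ)) [FiniteDimensional ℂ U]
    [FiniteDimensional ℂ V]
    (hUr : ∀ φ ∈ U, ∀ g : G, (fun h => φ (h * g)) ∈ U)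
    (hUl : ∀ φ ∈ U, ∀ g : G, (fun h => φ (g * h)) ∈ U)
    (φ : G → ℂ) (hφU : φ ∈ U) {X Y Z : Finset G}
    (hφN : ∀ x ∈ X, ∀ y ∈ Y, ∀ y' ∈ Y, ∀ z ∈ Z, y ≠ y' → φ (x * y⁻¹ * y' * z⁻¹) = 0)
    (hφQ : ∀ x ∈ X, ∀ z ∈ Z, φ (x * z⁻¹) ≠ 0)
    (hX : X.Nonempty) (hZ : Z.Nonempty)
    (hTPP : ∀ x ∈ X, ∀ x' ∈ X, ∀ y ∈ Y, ∀ y' ∈ Y, ∀ z ∈ Z, ∀ z' ∈ Z,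
      x * y⁻¹ * y' * z⁻¹ = x' * z'⁻¹ → x = x' ∧ y = y' ∧ z = z')
    (f : G → G → (G → ℂ)) (hf : IsSeparatingFamily X Y Z f)
    (hfV : ∀ x ∈ X, ∀ z ∈ Z, f x z ∈ V) :
    Y.card ≤ finrank ℂ U ∧ X.card * Y.card * Z.card ≤ finrank ℂ U * finrank ℂ V := by
  obtain ⟨x₀, hx₀⟩ := hX
  obtain ⟨z₀, hz₀⟩ := hZ
  -- the twist function `Φ(w) = φ(x₀ w z₀⁻¹)` lies in `U` by bi-invariance
  let Φ : G → ℂ := fun w => φ (x₀ * w * z₀⁻¹)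
  have hΦU : Φ ∈ U := by
    have h1 : (fun h => φ (x₀ * h)) ∈ U := hUl φ hφU x₀
    have h2 : (fun h => φ (x₀ * (h * z₀⁻¹))) ∈ U := hUr _ h1 z₀⁻¹
    have : Φ = fun h => φ (x₀ * (h * z₀⁻¹)) := by
      funext h; simp only [Φ, mul_assoc]
    rw [this]; exact h2
  have hΦ1 : Φ 1 ≠ 0 := by
    show φ (x₀ * 1 * z₀⁻¹) ≠ 0
    rw [mul_one]; exact hφQ x₀ hx₀ z₀ hz₀
  have htw : ∀ y ∈ Y, ∀ y' ∈ Y, y ≠ y' → Φ (y⁻¹ * y') = 0 := by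
    intro y hy y' hy' hne
    show φ (x₀ * (y⁻¹ * y') * z₀⁻¹) = 0
    have : x₀ * (y⁻¹ * y') * z₀⁻¹ = x₀ * y⁻¹ * y' * z₀⁻¹ := by group
    rw [this]; exact hφN x₀ hx₀ y hy y' hy' z₀ hz₀ hne
  exact ⟨card_le_finrank_of_twists_in_locus U hUr Φ hΦU hΦ1 Y htw,
    volume_le_of_twists_in_locus U V hUr Φ hΦU hΦ1 hTPP f hf hfV htw⟩


/-! ## A concrete instance: affine hyperplanes in `GL_n` -/

/-- Fintype-indexed form of the twist-rank lemma `card_le_of_twist_rank`. [new] -/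
theorem card_le_of_twist_rank_fintype {ι : Type*} [Fintype ι] (Y : Finset G) (Φ : G → ℂ)
    (u v : ι → G → ℂ) (hfac : ∀ y ∈ Y, ∀ y' ∈ Y, Φ (y⁻¹ * y') = ∑ k, u k y * v k y')
    (h1 : Φ 1 ≠ 0) (hY : ∀ y ∈ Y, ∀ y' ∈ Y, y ≠ y' → Φ (y⁻¹ * y') = 0) :
    Y.card ≤ Fintype.card ι := by
  classical
  let e := Fintype.equivFin ι
  refine card_le_of_twist_rank Y Φ (fun k => u (e.symm k)) (fun k => v (e.symm k)) ?_ h1 hY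
  intro y hy y' hy'
  rw [hfac y hy y' hy']
  exact (e.symm.sum_comp (fun i => u i y * v i y')).symm

/-- The affine function `w ↦ c + Σ_{i,j} L_{ij} w_{ij}` on `GL_n(ℂ)`. -/
def affineFun (n : ℕ) (c : ℂ) (L : Matrix (Fin n) (Fin n) ℂ) : GL (Fin n) ℂ → ℂ :=
  fun w => c + ∑ i, ∑ j, L i j * (w : Matrix (Fin n) (Fin n) ℂ) i j

/-- Value of the affine function at the identity: `c + tr L`. -/
theorem affineFun_one (n : ℕ) (c : ℂ) (L : Matrix (Fin n) (Fin n) ℂ) :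
    affineFun n c L 1 = c + L.trace := by
  simp [affineFun, Matrix.trace, Matrix.one_apply, mul_ite, Finset.sum_ite_eq]

/-- **Twists in an affine hyperplane of `GL_n(ℂ)` not through `1` force `|Y| ≤ n² + 1`**:
`Φ(y⁻¹y') = c + Σ_{i,k} (y⁻¹)_{ik} · (Σ_j L_{ij} y'_{kj})` has rank `≤ n² + 1`. (The case
`U = V_1` of `card_le_finrank_of_twists_in_locus`, made explicit.) [new] -/
theorem glN_card_le_of_affine_twists {n : ℕ} (Y : Finset (GL (Fin n) ℂ)) (c : ℂ)
    (L : Matrix (Fin n) (Fin n) ℂ) (h1 : c + L.trace ≠ 0)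
    (hY : ∀ y ∈ Y, ∀ y' ∈ Y, y ≠ y' → affineFun n c L (y⁻¹ * y') = 0) :
    Y.card ≤ n * n + 1 := by
  classical
  have h1' : affineFun n c L 1 ≠ 0 := by rwa [affineFun_one]
  have key := card_le_of_twist_rank_fintype (ι := Option (Fin n × Fin n)) Y (affineFun n c L)
    (fun o y => o.elim c fun ik => ((y⁻¹ : GL (Fin n) ℂ) : Matrix (Fin n) (Fin n) ℂ) ik.1 ik.2)
    (fun o y' => o.elim 1 fun ik => ∑ j, L ik.1 j * (y' : Matrix (Fin n) (Fin n) ℂ) ik.2 j)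
    ?_ h1' hY
  · simpa [Fintype.card_option, Fintype.card_prod, Fintype.card_fin] using key
  intro y _ y' _
  simp only [affineFun, Fintype.sum_option, Option.elim, mul_one, Units.val_mul,
    Matrix.mul_apply, Fintype.sum_prod_type]
  congr 1
  refine Finset.sum_congr rfl fun i _ => ?_
  simp only [Finset.mul_sum]
  rw [Finset.sum_comm]
  exact Finset.sum_congr rfl fun k _ => Finset.sum_congr rfl fun j _ => by ring

end Summit.MatrixMultiplication.MatrixMultiplication.Theorems

end
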